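import Summits.ABC.IUTFork.Thm311RealInd1StripDepthEDichotomy
import Summits.ABC.IUTFork.Thm311RealInd1StripPacketFloor
import HarnessLib

/-!
# [IUTchIII] Thm 3.11 (i) (Ind1)+(Ind2) on a TENSOR PACKET of genuine completions: the packet FLOOR with the residue-degree hypothesis REPLACED
# by the depth-`e` BIT at the `f = 1` factors (modulo `JannsenWingbergMappingClass`)

PROOF-ONLY file (abc-iut cell, Cor. 3.12 sub-crew, seat abc-iut-c312-1 = holder of record of the typed [IUTchIII] Thm. 3.11, gen 18; row
«R24 = C:F1-DEPTH-E-DICHOTOMY», KEY F1DICHOTOMY, C LEAD ruling C-R152 (f); file 3 of the row — the packet form of file 2's branch (i)).  TAKES NO SIDE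
on [IUTchIII] Cor. 3.12.

WHY.  Gen 15's packet floor `packetHull_eq_of_balls_of_jannsenWingbergMappingClass` (p535531) — the print-side core of the Θ-junction files R21–R23
(p538494 … p547431) — excludes, factor by factor, the ball `c_i·𝔪^{n_i}` with `n_i = e_i ∧ f(w_i|p) = 1` (hypothesis `hexc`, whence `hf`/`hram`/`hres`
downstream): at a genuine place-section packet every box factor off the twisted slot IS such a depth-`e` ball (`p⁻¹·𝔪^{e_b} = 𝒪_b`).  File 2
(`Thm311RealInd1StripDepthEDichotomy`, p550723) supplies the single-place floor at those factors from ONE displayed bit on the realised strip group: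
«some `ψ ∈ Real.ind1StripOf w_i (galoisLog w_i)` moves the base line `ℤ_p·p` modulo `p·log_p(𝒪_{w_i}^×) = 𝔪^{e_i+1}`».  This file assembles:

* §1 (UNCONDITIONAL engine) **`tprod_mem_of_factor_stableSubgroups`** — variant of gen 15's `tprod_mem_of_factor_closures` for the FULL
  single-place strip orbit: if `N ≤ X = ⊗_{ℚ_p,i} K_{w_i}` contains the pure tensors of the factor regions `M_i` and is closed under single-factor
  strip moves on pure tensors, then `⊗_i z_i ∈ N` whenever each `z_i` lies in EVERY additive subgroup of `K_{w_i}` containing `M_i` and stable under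
  the realised strip automorphisms (the slot subgroup `{δ : ⊗ z[a ↦ δ] ∈ N}` is such a subgroup — induction on the slots).
* §2 (mod `JannsenWingbergMappingClass`; every factor tame of ODD local degree `≥ 3`; factor balls `c_i·𝔪^{n_i}`, `1 ≤ n_i ≤ e_i`)
  **`exists_tprod_mem_norm_eq_of_balls_bit_of_jannsenWingbergMappingClass`** — `hexc` REPLACED by `hbit : ∀ i, n_i = e_i → f(w_i|p) = 1 → (the
  bit at w_i)`: `N` contains a pure tensor `⊗_i y_i` with `‖y_i‖ = ‖c_i‖·p^{−1/e_i}` (`y_i = c_i·w_i`, `w_i` the co-radial trace-zero log-unit of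
  p527172, which lies in every strip-stable subgroup containing the ball: by p533915's floor off the residue, by file 2's floor at the residue);
  hence **`packetHull_eq_of_balls_bit_of_jannsenWingbergMappingClass`**: inside the hull of the container span `(Π_i c_i)·log_p(R_I^×)`,
  `packetHull(N) = packetHull((Π_i c_i)·log_p(R_I^×))` — p535531's conclusion with the residue hypothesis replaced by the displayed bit.
READING (numbers about OUR typed objects; neutral): the packet floor of the tame odd-degree junction programme depends, at each factor ball of
depth `e_i` and residue degree one, on exactly ONE bit of the realised strip group at that place (file 2: if the bit fails the factor ball is
strip-INVARIANT, p550084); nothing here decides any bit.  HONEST SCOPE: conditional on `hMC`; OUR typing of print's (Ind1) (THE equivariant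
lift, THE logarithm; single-factor action as in p516014; F-B28-1 untouched); only pure tensors of factor balls are used; nothing here computes a
log-volume; no side taken on [IUTchIII] Cor. 3.12 / [IUTchIV] Thm. 1.10 or on any author; NO abc claim. [claim: Mochizuki2012, status: disputed];
[cite: Mochizuki2012, IUTchIII Thm. 3.11 (i) p. 154; Rmk. 3.9.5 (i) p. 127; Cor. 3.12 Step (xi) p. 183; IUTchIV Prop. 1.4 (i) p. 13];
[cite: Kondo2025OuterAutMLF, §3 Thm 3.17, Rem 3.18]; [cite: DupuyHilado2025, §4.9, §4.12]; [cite: SerreLocalFields1979, Ch. III §6, Prop. 13].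
typed ≠ proved; a conditional theorem discharges nothing it binds; equal-AS-TYPED ≠ equal in print.
-/

set_option autoImplicit false

noncomputable section

open Metric Set Bornology Function
open scoped Pointwise TensorProduct

namespace Summit.ABC.IUTFork.Thm311.Real

open NumberField IsDedekindDomain Literature.NumberTheory.NumberFields Literature.IUT.LogVolume
open Literature.NumberTheory.GaloisRepresentations Literature.NumberTheory.GaloisRepresentations.Ultrametric
open Literature.AnabelianGeometry.AbsoluteAnabelian Literature.IUT.HodgeArakelov
open Literature.IUT.HodgeArakelov.AbsTopMonoids

variable {K : Type} [Field K] [NumberField K] (p : ℕ) [hp : Fact p.Prime]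
variable {I : Type} [Fintype I] [DecidableEq I] (w : I → HeightOneSpectrum (𝓞 K)) (hw : ∀ i, ((p : ℕ) : 𝓞 K) ∈ (w i).asIdeal)

/-! ## §1 The engine for the FULL single-place strip orbit: pure tensors of strip-stable hulls lie in `N` -/

/-- **Pure tensors whose factors lie in every strip-stable subgroup over `M_i` lie in `N` (UNCONDITIONAL).**  If `N ≤ X = ⊗_i K_{w_i}` contains the
pure tensors of the factor regions `M_i` and is closed under single-factor strip moves on pure tensors, then `⊗_i z_i ∈ N` whenever each `z_i`
belongs to EVERY additive subgroup of `K_{w_i}^{(1/n)}` that contains (the image of) `M_i` and is stable under the realised strip automorphisms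
`Real.ind1StripOf w_i (galoisLog w_i)`: by induction on the slots already moved, the slot subgroup `{δ : ⊗ z[a ↦ δ] ∈ N}` contains `M_a`
(induction hypothesis) and is strip-stable (the single-factor closure of `N`). Variant of `tprod_mem_of_factor_closures` (p535531 §1, two-step
orbit) for the full orbit. [claim: Mochizuki2012, status: disputed] [cite: Mochizuki2012, IUTchIII Thm. 3.11 (i) p. 154] -/
theorem tprod_mem_of_factor_stableSubgroups (M : ∀ i, Set ((w i).adicCompletion K))
    (N : AddSubgroup (PacketAlgebra p (fun i => RescaledCompletion K p (w i) (hw i))))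
    (hM : ∀ x : Π i, (w i).adicCompletion K, (∀ i, x i ∈ M i) →
      PiTensorProduct.tprod ℚ_[p] (fun i => RescaledCompletion.of K p (w i) (hw i) (x i)) ∈ N)
    (hN : ∀ (i₀ : I), ∀ ψ ∈ ind1StripOf (w i₀) (galoisLog (w i₀)), ∀ z : Π i, RescaledCompletion K p (w i) (hw i),
      PiTensorProduct.tprod ℚ_[p] z ∈ N →
        PiTensorProduct.tprod ℚ_[p] (update z i₀ (RescaledCompletion.of K p (w i₀) (hw i₀)
          (ψ ((RescaledCompletion.of K p (w i₀) (hw i₀)).symm (z i₀))))) ∈ N)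
    (z : Π i, RescaledCompletion K p (w i) (hw i))
    (hz : ∀ i, ∀ D : AddSubgroup (RescaledCompletion K p (w i) (hw i)),
      (∀ x ∈ M i, RescaledCompletion.of K p (w i) (hw i) x ∈ D) →
      (∀ ψ ∈ ind1StripOf (w i) (galoisLog (w i)), ∀ δ ∈ D,
        RescaledCompletion.of K p (w i) (hw i) (ψ ((RescaledCompletion.of K p (w i) (hw i)).symm δ)) ∈ D) →
      z i ∈ D) :
    PiTensorProduct.tprod ℚ_[p] z ∈ N := by
  classical
  set e := fun i => RescaledCompletion.of K p (w i) (hw i) with he_def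
  -- induction on the set `S` of slots carrying hull elements (the others carry `e(M)` elements)
  suffices h : ∀ (S : Finset I) (z : Π i, RescaledCompletion K p (w i) (hw i)),
      (∀ i ∈ S, ∀ D : AddSubgroup (RescaledCompletion K p (w i) (hw i)), (∀ x ∈ M i, e i x ∈ D) →
        (∀ ψ ∈ ind1StripOf (w i) (galoisLog (w i)), ∀ δ ∈ D, e i (ψ ((e i).symm δ)) ∈ D) → z i ∈ D) →
      (∀ i ∉ S, z i ∈ e i '' M i) → PiTensorProduct.tprod ℚ_[p] z ∈ N from
    h Finset.univ z (fun i _ => hz i) (fun i hi => absurd (Finset.mem_univ i) hi)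
  intro S
  induction S using Finset.induction_on with
  | empty =>
    intro z _ hzM
    choose x hxM hxz using fun i => hzM i (Finset.notMem_empty i)
    have : z = fun i => e i (x i) := funext fun i => (hxz i).symm
    rw [this]
    exact hM x hxM
  | insert a S haS ih =>
    intro z hzC hzM
    -- the slot-`a` map `δ ↦ ⊗ z[a ↦ δ]` is additive; the set of `δ` landing in `N` is a subgroup `D`
    let φ : RescaledCompletion K p (w a) (hw a) →ₗ[ℚ_[p]] PacketAlgebra p (fun i => RescaledCompletion K p (w i) (hw i)) :=
      (PiTensorProduct.tprod ℚ_[p]).toLinearMap z a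
    have hφ : ∀ δ, φ δ = PiTensorProduct.tprod ℚ_[p] (update z a δ) := fun δ => rfl
    let D : AddSubgroup (RescaledCompletion K p (w a) (hw a)) := N.comap φ.toAddMonoidHom
    -- every slot-`a` value from `e(M_a)` works, by the induction hypothesis
    have hbase : ∀ x ∈ M a, PiTensorProduct.tprod ℚ_[p] (update z a (e a x)) ∈ N := by
      intro x hx
      refine ih (update z a (e a x)) (fun i hi => ?_) (fun i hi => ?_)
      · have hia : i ≠ a := fun h => haS (h ▸ hi)
        rw [update_of_ne hia]
        exact hzC i (Finset.mem_insert_of_mem hi)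
      · by_cases hia : i = a
        · subst hia; rw [update_self]; exact ⟨x, hx, rfl⟩
        · rw [update_of_ne hia]
          exact hzM i (fun h => (Finset.mem_insert.mp h).elim hia hi)
    -- `D` contains `e(M_a)` and is strip-stable, hence contains `z a`
    have hD₁ : ∀ x ∈ M a, e a x ∈ D := by
      intro x hx
      change φ (e a x) ∈ N
      rw [hφ]; exact hbase x hx
    have hD₂ : ∀ ψ ∈ ind1StripOf (w a) (galoisLog (w a)), ∀ δ ∈ D, e a (ψ ((e a).symm δ)) ∈ D := by
      intro ψ hψ δ hδ
      change φ (e a (ψ ((e a).symm δ))) ∈ N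
      rw [hφ]
      have hδ' : PiTensorProduct.tprod ℚ_[p] (update z a δ) ∈ N := by
        have h : φ δ ∈ N := hδ
        rwa [hφ] at h
      have h := hN a ψ hψ (update z a δ) hδ'
      rwa [update_self, update_idem] at h
    have hzaD : z a ∈ D := hzC a (Finset.mem_insert_self a S) D hD₁ hD₂
    have h : φ (z a) ∈ N := hzaD
    rwa [hφ, update_eq_self] at h

/-! ## §2 The packet floor with the depth-`e` bit at the `f = 1` factors -/

set_option maxHeartbeats 400000 in
/-- **A FULL-RADIUS PURE TENSOR IN THE PRINT-(Ind1) ORBIT SPAN, the residue hypothesis replaced by the depth-`e` bit (modulo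
`JannsenWingbergMappingClass`).**  On the genuine packet `X = ⊗_{ℚ_p, i} K_{w_i}` with EVERY factor tame (`p > 2`, `e_i ≤ p − 2`) of ODD local
degree `≥ 3`, let the factor regions be the balls `{‖x‖ ≤ ‖c_i‖·p^{−n_i/e_i}}` (`c_i ≠ 0`, `1 ≤ n_i ≤ e_i`), and suppose that at every factor with
`n_i = e_i ∧ f(w_i|p) = 1` SOME realised strip automorphism moves the base line `ℤ_p·p` modulo `p·log_p(𝒪_{w_i}^×)` (the displayed bit of file 2).
Every additive subgroup `N ≤ X` containing the pure tensors of the balls and closed under single-factor strip moves on pure tensors contains a pure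
tensor `⊗_i y_i` with `‖y_i‖ = ‖c_i‖·p^{−1/e_i}` for all `i` (`y_i = c_i·w_i`, `w_i` co-radial trace-zero: in every strip-stable subgroup over
the ball by p533915 off the residue and by p550723 at the residue; fed to §1). [claim: Mochizuki2012, status: disputed]
[cite: Mochizuki2012, IUTchIII Thm. 3.11 (i) p. 154] [cite: Kondo2025OuterAutMLF, §3 Thm 3.17, Rem 3.18] [cite: SerreLocalFields1979, Ch. III §6, Prop. 13] -/
theorem exists_tprod_mem_norm_eq_of_balls_bit_of_jannsenWingbergMappingClass (hMC : JannsenWingbergMappingClass) (hp2 : 2 < p)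
    (he : ∀ i, absRamificationIdx p (RescaledCompletion K p (w i) (hw i)) ≤ p - 2)
    (h3 : ∀ i, 3 ≤ localDeg K (w i)) (hodd : ∀ i, Odd (localDeg K (w i)))
    (c : I → ℚ_[p]) (hc : ∀ i, c i ≠ 0) (n : I → ℕ) (hn1 : ∀ i, 1 ≤ n i)
    (hne : ∀ i, n i ≤ absRamificationIdx p (RescaledCompletion K p (w i) (hw i)))
    (hbit : ∀ i, n i = absRamificationIdx p (RescaledCompletion K p (w i) (hw i)) → (w i).asIdeal.inertiaDeg ℤ = 1 →
      ∃ ψ ∈ ind1StripOf (w i) (galoisLog (w i)),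
        RescaledCompletion.of K p (w i) (hw i) (ψ (p : (w i).adicCompletion K)) - (p : RescaledCompletion K p (w i) (hw i)) ∉
          (p : ℚ_[p]) • logUnits (RescaledCompletion K p (w i) (hw i)))
    (N : AddSubgroup (PacketAlgebra p (fun i => RescaledCompletion K p (w i) (hw i))))
    (hM : ∀ x : Π i, (w i).adicCompletion K,
      (∀ i, ‖RescaledCompletion.of K p (w i) (hw i) (x i)‖ ≤
        ‖c i‖ * (p : ℝ) ^ (-((n i : ℝ) / (absRamificationIdx p (RescaledCompletion K p (w i) (hw i)) : ℝ)))) →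
      PiTensorProduct.tprod ℚ_[p] (fun i => RescaledCompletion.of K p (w i) (hw i) (x i)) ∈ N)
    (hN : ∀ (i₀ : I), ∀ ψ ∈ ind1StripOf (w i₀) (galoisLog (w i₀)), ∀ z : Π i, RescaledCompletion K p (w i) (hw i),
      PiTensorProduct.tprod ℚ_[p] z ∈ N →
        PiTensorProduct.tprod ℚ_[p] (update z i₀ (RescaledCompletion.of K p (w i₀) (hw i₀)
          (ψ ((RescaledCompletion.of K p (w i₀) (hw i₀)).symm (z i₀))))) ∈ N) :
    ∃ y : Π i, RescaledCompletion K p (w i) (hw i),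
      (∀ i, ‖y i‖ = ‖c i‖ * (p : ℝ) ^ (-(1 / (absRamificationIdx p (RescaledCompletion K p (w i) (hw i)) : ℝ)))) ∧
      PiTensorProduct.tprod ℚ_[p] y ∈ N := by
  classical
  set k := fun i => RescaledCompletion K p (w i) (hw i) with hk
  set e := fun i => RescaledCompletion.of K p (w i) (hw i) with he_def
  have hP : p.Prime := Fact.out
  have hp0 : (0 : ℝ) < p := by exact_mod_cast hP.pos
  let M : ∀ i, Set ((w i).adicCompletion K) := fun i =>
    {x | ‖e i x‖ ≤ ‖c i‖ * (p : ℝ) ^ (-((n i : ℝ) / (absRamificationIdx p (k i) : ℝ)))}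
  -- the co-radial trace-zero log-unit of each factor (tame, degree ≥ 2)
  have hd2 : ∀ i, 2 ≤ Module.finrank ℚ_[p] (k i) := fun i => by
    change 2 ≤ Module.finrank ℚ_[p] (RescaledCompletion K p (w i) (hw i))
    rw [finrank_rescaledCompletion_eq_localDeg]; exact (show 2 ≤ 3 by norm_num).trans (h3 i)
  have hcorad : ∀ i, ∃ z ∈ logUnits (k i), Algebra.trace ℚ_[p] (k i) z = 0 ∧
      ‖z‖ = (p : ℝ) ^ (-(1 / (absRamificationIdx p (k i) : ℝ))) := by
    intro i
    obtain ⟨z, hz, hzT, hzn, -⟩ :=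
      TraceZeroCoradial.exists_mem_logUnits_trace_eq_zero_isMaxOn_of_tame p (k i) hp2 (he i) (hd2 i)
    exact ⟨z, hz, hzT, hzn⟩
  choose zc hzcL hzcT hzcn using hcorad
  refine ⟨fun i => c i • zc i, fun i => by rw [norm_smul, hzcn], ?_⟩
  refine tprod_mem_of_factor_stableSubgroups p w hw M N hM hN _ fun i D hD₁ hD₂ => ?_
  -- factor `i`: `c_i·zc_i` lies in the floor `c_i·(log_p ∩ Ker Tr)`, which every strip-stable `D ⊇ M_i` contains
  have hmem : c i • zc i ∈ c i • (logUnits (k i) ∩ {x | Algebra.trace ℚ_[p] (k i) x = 0}) :=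
    Set.smul_mem_smul_set ⟨hzcL i, hzcT i⟩
  have horb : ∀ ψ ∈ ind1StripOf (w i) (galoisLog (w i)), ∀ x : (w i).adicCompletion K,
      ‖e i x‖ ≤ ‖c i‖ * (p : ℝ) ^ (-((n i : ℝ) / (absRamificationIdx p (k i) : ℝ))) →
        e i (ψ x) ∈ D ∧ ∀ ψ' ∈ ind1StripOf (w i) (galoisLog (w i)), e i (ψ' (ψ x)) ∈ D := by
    intro ψ hψ x hx
    have h1 : e i (ψ x) ∈ D := by
      have h := hD₂ ψ hψ _ (hD₁ x hx)
      rwa [(e i).symm_apply_apply] at h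
    refine ⟨h1, fun ψ' hψ' => ?_⟩
    have h := hD₂ ψ' hψ' _ h1
    rwa [(e i).symm_apply_apply] at h
  by_cases hexc : ¬ (n i = absRamificationIdx p (k i) ∧ (w i).asIdeal.inertiaDeg ℤ = 1)
  · -- off the residue: gen 15's floor (two-step closure suffices)
    obtain ⟨hfloor, -, -⟩ := smul_inter_ker_subset_of_ball_of_jannsenWingbergMappingClass (w i) hMC p (hw i) hp2 (he i)
      (h3 i) (hodd i) (hc i) (hn1 i) (hne i) hexc D (fun x hx => hD₁ x hx) horb
    exact hfloor hmem
  · -- at the residue: the depth-`e` floor from the bit (file 2)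
    rw [not_not] at hexc
    obtain ⟨hni, hfi⟩ := hexc
    have hrad : ‖c i‖ * (p : ℝ) ^ (-((n i : ℝ) / (absRamificationIdx p (k i) : ℝ))) = ‖c i‖ * (p : ℝ)⁻¹ := by
      have hE0 : (absRamificationIdx p (k i) : ℝ) ≠ 0 := by exact_mod_cast (absRamificationIdx_pos p (k i)).ne'
      rw [hni, div_self hE0, Real.rpow_neg_one]
    obtain ⟨hfloor, -, -⟩ := smul_inter_ker_subset_of_depthE_ball_of_movesBaseLine_of_jannsenWingbergMappingClass (w i) hMC p
      (hw i) hp2 (he i) (h3 i) (hodd i) (hc i) (hbit i hni hfi) D (fun x hx => hD₁ x (by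
        show ‖e i x‖ ≤ ‖c i‖ * (p : ℝ) ^ (-((n i : ℝ) / (absRamificationIdx p (k i) : ℝ))); rw [hrad]; exact hx)) hD₂
    exact hfloor hmem

/-- **THE PACKET FLOOR = THE CONTAINER HULL, residue hypothesis replaced by the depth-`e` bit (modulo `JannsenWingbergMappingClass`).**  Same
setting (`I` nonempty).  If moreover `N` lies inside the `(R_I)^∼`-hull of the container span `(Π_i c_i)·log_p(R_I^×)` — as the print-(Ind1)⊔(Ind2)
orbit span of the Θ-region does — then `packetHull(N) = packetHull((Π_i c_i)·log_p(R_I^×))`: p535531's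
`packetHull_eq_of_balls_of_jannsenWingbergMappingClass` with `hexc` replaced by the displayed bit at the `f = 1` depth-`e` factors (the full-radius
pure tensor realises the container's maximal radius in every component of the chosen decomposition). [claim: Mochizuki2012, status: disputed]
[cite: Mochizuki2012, IUTchIII Rmk. 3.9.5 (i) p. 127; Cor. 3.12 Step (xi) p. 183; IUTchIV Prop. 1.4 (i) p. 13] [cite: DupuyHilado2025, §4.9, §4.12] -/
theorem packetHull_eq_of_balls_bit_of_jannsenWingbergMappingClass [Nonempty I] (hMC : JannsenWingbergMappingClass) (hp2 : 2 < p)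
    (he : ∀ i, absRamificationIdx p (RescaledCompletion K p (w i) (hw i)) ≤ p - 2)
    (h3 : ∀ i, 3 ≤ localDeg K (w i)) (hodd : ∀ i, Odd (localDeg K (w i)))
    (c : I → ℚ_[p]) (hc : ∀ i, c i ≠ 0) (n : I → ℕ) (hn1 : ∀ i, 1 ≤ n i)
    (hne : ∀ i, n i ≤ absRamificationIdx p (RescaledCompletion K p (w i) (hw i)))
    (hbit : ∀ i, n i = absRamificationIdx p (RescaledCompletion K p (w i) (hw i)) → (w i).asIdeal.inertiaDeg ℤ = 1 →
      ∃ ψ ∈ ind1StripOf (w i) (galoisLog (w i)),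
        RescaledCompletion.of K p (w i) (hw i) (ψ (p : (w i).adicCompletion K)) - (p : RescaledCompletion K p (w i) (hw i)) ∉
          (p : ℚ_[p]) • logUnits (RescaledCompletion K p (w i) (hw i)))
    (N : AddSubgroup (PacketAlgebra p (fun i => RescaledCompletion K p (w i) (hw i))))
    (hM : ∀ x : Π i, (w i).adicCompletion K,
      (∀ i, ‖RescaledCompletion.of K p (w i) (hw i) (x i)‖ ≤
        ‖c i‖ * (p : ℝ) ^ (-((n i : ℝ) / (absRamificationIdx p (RescaledCompletion K p (w i) (hw i)) : ℝ)))) →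
      PiTensorProduct.tprod ℚ_[p] (fun i => RescaledCompletion.of K p (w i) (hw i) (x i)) ∈ N)
    (hN : ∀ (i₀ : I), ∀ ψ ∈ ind1StripOf (w i₀) (galoisLog (w i₀)), ∀ z : Π i, RescaledCompletion K p (w i) (hw i),
      PiTensorProduct.tprod ℚ_[p] z ∈ N →
        PiTensorProduct.tprod ℚ_[p] (update z i₀ (RescaledCompletion.of K p (w i₀) (hw i₀)
          (ψ ((RescaledCompletion.of K p (w i₀) (hw i₀)).symm (z i₀))))) ∈ N)
    (hNc : (N : Set (PacketAlgebra p (fun i => RescaledCompletion K p (w i) (hw i)))) ⊆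
      packetHull p (fun i => RescaledCompletion K p (w i) (hw i))
        ((∏ i, c i) • (logPacket p (fun i => RescaledCompletion K p (w i) (hw i)) : Set _))) :
    packetHull p (fun i => RescaledCompletion K p (w i) (hw i)) (N : Set _) =
      packetHull p (fun i => RescaledCompletion K p (w i) (hw i))
        ((∏ i, c i) • (logPacket p (fun i => RescaledCompletion K p (w i) (hw i)) : Set _)) := by
  classical
  obtain ⟨y, hyn, hyN⟩ := exists_tprod_mem_norm_eq_of_balls_bit_of_jannsenWingbergMappingClass p w hw hMC hp2 he h3 hodd c hc n
    hn1 hne hbit N hM hN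
  set k := fun i => RescaledCompletion K p (w i) (hw i)
  set C : Set (PacketAlgebra p k) := (∏ i, c i) • (logPacket p k : Set (PacketAlgebra p k)) with hC
  set ψ := dEquiv p k
  -- co-radial maximal log-units in each factor (tame, degree ≥ 2)
  have hd2 : ∀ i, 2 ≤ Module.finrank ℚ_[p] (k i) := fun i => by
    change 2 ≤ Module.finrank ℚ_[p] (RescaledCompletion K p (w i) (hw i))
    rw [finrank_rescaledCompletion_eq_localDeg]; exact (show 2 ≤ 3 by norm_num).trans (h3 i)
  have hmaxes : ∀ i, ∃ z ∈ logUnits (k i), ‖z‖ = (p : ℝ) ^ (-(1 / (absRamificationIdx p (k i) : ℝ))) ∧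
      ∀ z' ∈ logUnits (k i), ‖z'‖ ≤ ‖z‖ := by
    intro i
    obtain ⟨z, hz, -, hzn, hzmax⟩ :=
      TraceZeroCoradial.exists_mem_logUnits_trace_eq_zero_isMaxOn_of_tame p (k i) hp2 (he i) (hd2 i)
    exact ⟨z, hz, hzn, hzmax⟩
  choose zm hzm hzmn hzmax using hmaxes
  set R : ℝ := ‖∏ i, c i‖ * ∏ i, ‖zm i‖ with hR
  have hRy : ∀ j, ‖ψ (PiTensorProduct.tprod ℚ_[p] y) j‖ = R := by
    intro j
    have h := psi_purePacket_apply p k (DFac p k) ψ y j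
    simp only [purePacket] at h
    rw [h, norm_prod, hR, norm_prod, ← Finset.prod_mul_distrib]
    refine Finset.prod_congr rfl fun i _ => ?_
    rw [norm_factorEmb, hyn, hzmn]
  -- radii of the container and of `N`
  have hCle : ∀ x ∈ C, ∀ j, ‖ψ x j‖ ≤ R := fun x hx j =>
    PacketHull.norm_apply_le_of_mem_smul_logPacket p k (DFac p k) ψ zm hzmax (∏ i, c i) hx j
  have hR0 : 0 ≤ R := mul_nonneg (norm_nonneg _) (Finset.prod_nonneg fun i _ => norm_nonneg _)
  have hCbdd : IsBounded (ψ '' C) := by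
    refine (isBounded_polydisc (DFac p k) (fun _ => R)).subset ?_
    rintro _ ⟨x, hx, rfl⟩
    exact (mem_polydisc (DFac p k)).mpr (hCle x hx)
  have hradC : ∀ j, hullRadius (DFac p k) (ψ '' C) j ≤ R := fun j =>
    hullRadius_le_of_nonneg (DFac p k) hR0 (by rintro _ ⟨x, hx, rfl⟩; exact hCle x hx j)
  -- `ψ(N)` sits inside the hull polydisc of `ψ(C)`, hence is bounded with radii `≤` those of `ψ(C)`
  have hNsub : ψ '' (N : Set (PacketAlgebra p k)) ⊆ polydisc (DFac p k) (hullRadius (DFac p k) (ψ '' C)) := by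
    rintro _ ⟨x, hx, rfl⟩
    have h := hNc hx
    rw [packetHull_eq_preimage_holomorphicHull p k (DFac p k) ψ hCbdd, Set.mem_preimage,
      holomorphicHull_of_isBounded (DFac p k) hCbdd] at h
    exact h
  have hNbdd : IsBounded (ψ '' (N : Set (PacketAlgebra p k))) := (isBounded_polydisc (DFac p k) _).subset hNsub
  have hradN_le : ∀ j, hullRadius (DFac p k) (ψ '' (N : Set (PacketAlgebra p k))) j ≤ hullRadius (DFac p k) (ψ '' C) j := fun j =>
    hullRadius_le_of_subset_polydisc (DFac p k) (fun j => hullRadius_nonneg (DFac p k) _ j) hNsub j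
  have hradN_ge : ∀ j, R ≤ hullRadius (DFac p k) (ψ '' (N : Set (PacketAlgebra p k))) j := by
    intro j
    rw [← hRy j]
    exact norm_apply_le_hullRadius (DFac p k) hNbdd ⟨_, hyN, rfl⟩ j
  have hrad : ∀ j, hullRadius (DFac p k) (ψ '' (N : Set (PacketAlgebra p k))) j = hullRadius (DFac p k) (ψ '' C) j := fun j =>
    le_antisymm (hradN_le j) ((hradC j).trans (hradN_ge j))
  have hhull : holomorphicHull (DFac p k) (ψ '' (N : Set (PacketAlgebra p k))) = holomorphicHull (DFac p k) (ψ '' C) := by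
    rw [holomorphicHull_of_isBounded (DFac p k) hNbdd, holomorphicHull_of_isBounded (DFac p k) hCbdd]
    congr 1; funext j; exact hrad j
  rw [packetHull_eq_preimage_holomorphicHull p k (DFac p k) ψ hNbdd, packetHull_eq_preimage_holomorphicHull p k (DFac p k) ψ hCbdd, hhull]

end Summit.ABC.IUTFork.Thm311.Real

end
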